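import Literature.NumberTheory.LFunctions.MertensErrorTermsMeanValueRHPiLiLandau
import Literature.NumberTheory.LFunctions.MertensErrorTermsMeanValueRHPiLiWindow
import Literature.NumberTheory.LFunctions.MertensErrorTermsMeanValueRHThm1Clause1
import Literature.NumberTheory.LFunctions.MertensSecondErrorPositive
import Literature.NumberTheory.LFunctions.SchoenfeldPiIntegral
import Literature.NumberTheory.LFunctions.ChebyshevPsiExplicit
import HarnessLib

/-!
# RH-EQUIVALENT literature, proof layer — «nothing here bears on the truth of RH»
# Zhao 2025, Theorem 1, clause `i = 2`, AS PRINTED: `RH ⟺ ∫₂^X E₂(x) dx > 0` for ALL `X > 2` — PROVED;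
# the named fact `Zhao2025MertensMean_thm1` DISCHARGED (`Zhao2025MertensMean_thm1_holds`)

Proof companion of `MertensErrorTermsMeanValueRH.lean` (T. Zhao, *On the mean values of the error terms in
Mertens' theorems*, Res. Number Theory **11** (2025) 62 = arXiv:2411.18903 [bib: `Zhao2025MertensMean`], refereed);
theorems only — no definition, no named fact. `E₂(x) = Σ_{p ≤ x} 1/p − log log x − B` (`Zhao2025.E₂`).

The tree held: `⟸` as printed (`Zhao2025.riemannHypothesis_of_integral_E₂_pos`, Landau's theorem,
`MertensErrorTermsMeanValueRHPiLiLandau.lean`); `⟹` for all SUFFICIENTLY LARGE `X` with an inexplicit threshold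
(`Zhao2025.eventually_integral_E₂_pos_of_RH`); clause `i = 1` as printed (`MertensErrorTermsMeanValueRHThm1Clause1.lean`);
and the RH-free kernel certificate `Zhao2025.E₂_pos_of_lt` — `E₂(x) > 0` for `2 ≤ x < 358811`
(`MertensSecondErrorPositive.lean`; the source's numerical input is «`E_i(x) > 0` for `2 ≤ x ≤ 10⁸`» [RS]).
This file makes the source's §2 argument for `E₂` EXPLICIT down to `X₁ = 358801 = 599²`, with standard axioms only
(no `native_decide` input: the `ψ − θ` bounds are taken from Chebyshev's elementary estimates, not from Schoenfeld's tables):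

* §0–§1 numerics (`log 2π`, kernel logarithms of `11`, `599`, `358801`) and **`J(11) ≤ 0`** (`θ(u) ≤ u` on `[2, 11]`
  from five primorials), `J(t) = ∫₂ᵗ (θ(u) − u)/(u log² u) du`;
* §2–§3 **the one-sided explicit Lemma 6 under RH**: `J(t) ≤ 1.88 + (0.132/log t + 0.55/log² t)√t` for `t ≥ 358801`
  (`J_le_explicit_of_RH`): `θ ≤ ψ` and Schoenfeld's integration by parts against `ψ₁`
  (`SchoenfeldBound.abs_integral_psi_sub_mul_w_le`) on `[11, √t]` and `[√t, t]`;
* §4 RH-free Chebyshev inputs: **`ψ − θ ≥ 0.86√t`** for `t ≥ 358801` (`ψ − θ ≥ ψ(√t)`, Mathlib, and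
  `ψ(n) ≥ An − 5 log n`, `ChebyshevExplicit.psi_ge_chebyshev`) and an explicit majorant of `∫_u^∞ (ψ − θ)/v²`
  (`ψ − θ ≤ ψ(v^{1/2}) + ψ(v^{1/3}) + ψ(v^{1/5})`, Mathlib; `ψ(n) ≤ 1.1056n + 3log²n + 80`), whence under RH the
  two-sided explicit `θ`-tail `T(u) = ∫_u^∞ (θ − t)/t²` (Rosser–Schoenfeld's Lemma 7 in exact form, `K = β/√u`);
* §5–§7 with `T₂(X) = ∫_X^∞ (π − li)/t² = T(X)/log X − ∫_X^∞ T/(t log² t) + ∫_X^∞ (J + κ₀)/t²` (`piLiTail_eq`, the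
  tree's (2.6)-route): **`X·T₂(X) ≤ −8 + κ₀`** (`κ₀ = 2/log 2 − li 2`) for every `X ≥ 358801` under RH, hence by (2.4)–(2.5)
  **`∫₂^X E₂ > 0` for `X ≥ 358801`** (`integral_E₂_pos_of_RH_of_ge`; `li 2` cancels, `B > 0.26146`, `log log 2 ≥ 1 − 1/log 2`);
* §8 with the kernel certificate below `358811`: **`Zhao2025.integral_E₂_pos_of_RH`** (`RH ⟹ ∀ X > 2, ∫₂^X E₂ > 0`),
  **`Zhao2025MertensMean_thm1_clause2`**, and **`Zhao2025MertensMean_thm1_holds : Zhao2025MertensMean_thm1`**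
  (with `Zhao2025MertensMean_thm1_clause1`).

RH-EQUIVALENT criterion; an equivalence says nothing about the truth of RH. 0 sorry, standard axioms.
-/

noncomputable section

open Filter Topology Set MeasureTheory
open scoped Real Chebyshev

namespace Literature.NumberTheory.LFunctions

namespace Zhao2025

open PsiTailIntegral NicolasJExplicit SchoenfeldBound
open Literature.Analysis.SpecialFunctions

/-! ### §0 Numerical constants -/

/-- `log 2π < 1.8379`. [folklore] -/
private theorem log_two_pi_lt : Real.log (2 * π) < 1.8379 := by
  rw [Real.log_mul (by norm_num) Real.pi_pos.ne']
  have h1 := Real.log_two_lt_d9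
  have h2 := Real.log_pi_lt_d20
  linarith

/-- `0 < log 2π`. [folklore] -/
private theorem log_two_pi_pos : 0 < Real.log (2 * π) := Real.log_pos (by linarith [Real.pi_gt_three])

/-- `2.3978952 < log 11` (`KernelLog.logIv 11`, evaluated by the kernel). [folklore] -/
private theorem log_eleven_gt : (2.3978952 : ℝ) < Real.log 11 := by
  have h := KernelLog.logIv_sound (n := 11) (lo := 2898877508017578593179883)
    (hi := 2898877508018054199050927) (by decide +kernel)
  have e11 : ((11 : ℕ) : ℝ) = 11 := by norm_num
  rw [e11] at h
  have : (2.3978952 : ℝ) < ((2898877508017578593179883 : ℤ) : ℝ) / 2 ^ 80 := by norm_num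
  linarith [h.1]

/-- `12.79 < log 358801` (`KernelLog.logIv 358801`, evaluated by the kernel). [folklore] -/
private theorem log_X₁_gt : (12.79 : ℝ) < Real.log 358801 := by
  have h := KernelLog.logIv_sound (n := 358801) (lo := 15462793738303129770460709)
    (hi := 15462793738303605377057123) (by decide +kernel)
  have e : ((358801 : ℕ) : ℝ) = 358801 := by norm_num
  rw [e] at h
  have : (12.79 : ℝ) < ((15462793738303129770460709 : ℤ) : ℝ) / 2 ^ 80 := by norm_num
  linarith [h.1]

/-! ### §1 `J(11) ≤ 0`: `θ(u) ≤ u` on `[2, 11]` -/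

/-- `θ(u) ≤ u` for `2 ≤ u ≤ 11` (`θ(2) = log 2`, `θ(4) = log 6`, `θ(6) = log 30`, `θ(10) = log 210`,
`θ(11) = log 2310`, bounded by powers of `2`). [folklore] -/
private theorem theta_le_self_of_le_eleven {u : ℝ} (h2 : 2 ≤ u) (h11 : u ≤ 11) : θ u ≤ u := by
  have hl2 := Real.log_two_lt_d9
  have hu0 : 0 ≤ u := by linarith
  -- `θ u = θ ⌊u⌋₊ ≤ θ m` whenever `u < m + 1`
  have key : ∀ m : ℕ, u < m + 1 → θ u ≤ Real.log (primorial m) := by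
    intro m hm
    rw [Chebyshev.theta_eq_theta_coe_floor u]
    have hfl : ⌊u⌋₊ ≤ m := by
      have := (Nat.floor_lt hu0).2 (by exact_mod_cast hm : u < ((m + 1 : ℕ) : ℝ))
      omega
    have := Chebyshev.theta_mono (Nat.cast_le.2 hfl : ((⌊u⌋₊ : ℕ) : ℝ) ≤ m)
    rw [Chebyshev.theta_eq_log_primorial (m : ℝ), Nat.floor_natCast] at this
    exact this
  have hpow : ∀ k : ℕ, Real.log ((2 : ℕ) ^ k : ℕ) = k * Real.log 2 := by
    intro k; push_cast; rw [Real.log_pow]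
  rcases lt_or_ge u 3 with hu3 | hu3
  · have h := key 2 (by norm_num; linarith)
    have e : primorial 2 = 2 ^ 1 := by decide
    rw [e, hpow] at h; push_cast at h; linarith
  rcases lt_or_ge u 5 with hu5 | hu5
  · have h := key 4 (by norm_num; linarith)
    have e : primorial 4 ≤ 2 ^ 3 := by decide
    have h' : Real.log (primorial 4 : ℕ) ≤ Real.log ((2 : ℕ) ^ 3 : ℕ) :=
      Real.log_le_log (by exact_mod_cast primorial_pos 4) (by exact_mod_cast e)
    rw [hpow] at h'; push_cast at h'; linarith
  rcases lt_or_ge u 7 with hu7 | hu7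
  · have h := key 6 (by norm_num; linarith)
    have e : primorial 6 ≤ 2 ^ 5 := by decide
    have h' : Real.log (primorial 6 : ℕ) ≤ Real.log ((2 : ℕ) ^ 5 : ℕ) :=
      Real.log_le_log (by exact_mod_cast primorial_pos 6) (by exact_mod_cast e)
    rw [hpow] at h'; push_cast at h'; linarith
  rcases lt_or_ge u 11 with hu11 | hu11
  · have h := key 10 (by norm_num; linarith)
    have e : primorial 10 ≤ 2 ^ 8 := by decide
    have h' : Real.log (primorial 10 : ℕ) ≤ Real.log ((2 : ℕ) ^ 8 : ℕ) :=
      Real.log_le_log (by exact_mod_cast primorial_pos 10) (by exact_mod_cast e)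
    rw [hpow] at h'; push_cast at h'; linarith
  · have h := key 11 (by norm_num; linarith)
    have e : primorial 11 ≤ 2 ^ 12 := by decide
    have h' : Real.log (primorial 11 : ℕ) ≤ Real.log ((2 : ℕ) ^ 12 : ℕ) :=
      Real.log_le_log (by exact_mod_cast primorial_pos 11) (by exact_mod_cast e)
    rw [hpow] at h'; push_cast at h'; linarith

/-- **`J(11) ≤ 0`**: `∫₂^{11} (θ(u) − u)/(u log² u) du ≤ 0` since `θ(u) ≤ u` on `[2, 11]`.
[cite: Zhao2025MertensMean, §2 (Lemma 6, the range below 10⁸)] -/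
theorem J_eleven_nonpos : ∫ u in (2 : ℝ)..11, (θ u - u) / (u * Real.log u ^ 2) ≤ 0 := by
  have hint := VonKochTransfer.intervalIntegrable_theta_sub_div (x := 11) (by norm_num)
  have h0 : IntervalIntegrable (fun _ : ℝ => (0 : ℝ)) volume 2 11 := intervalIntegrable_const
  have h := intervalIntegral.integral_mono_on (by norm_num : (2 : ℝ) ≤ 11) hint h0 fun u hu => ?_
  · simpa using h
  have hu1 : 1 < u := by linarith [hu.1]
  have hden : 0 < u * Real.log u ^ 2 := by
    have := Real.log_pos hu1; positivity
  have hθ : θ u - u ≤ 0 := by linarith [theta_le_self_of_le_eleven hu.1 hu.2]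
  have := div_le_div_of_nonneg_right hθ hden.le
  rwa [zero_div] at this

/-! ### §2 The Schoenfeld-type majorant, simplified -/

/-- `B(v) w(v) = (β√v + log 2π + 1/(2(v² − 1)))/log² v` for `v > 1` (`SchoenfeldBound.Bmaj`, `wt`). [folklore] -/
private theorem Bmaj_mul_wt_eq {v : ℝ} (hv : 1 < v) :
    Bmaj v * wt v =
      (nicolasBeta * Real.sqrt v + Real.log (2 * π) + 1 / (2 * (v ^ 2 - 1))) / Real.log v ^ 2 := by
  have hv0 : v ≠ 0 := by positivity
  have hl : Real.log v ≠ 0 := (Real.log_pos hv).ne'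
  have h21 : 2 * (v ^ 2 - 1) ≠ 0 := by nlinarith
  unfold Bmaj wt
  field_simp

/-- `B(v) w(v) ≤ (0.0474 √v + 1.8421)/log² v` for `v ≥ 11` (`β < 0.0474`, `log 2π < 1.8379`,
`1/(2(v² − 1)) ≤ 1/240`). [folklore] -/
private theorem Bmaj_mul_wt_le {v : ℝ} (hv : 11 ≤ v) :
    Bmaj v * wt v ≤ (0.0474 * Real.sqrt v + 1.8421) / Real.log v ^ 2 := by
  rw [Bmaj_mul_wt_eq (by linarith)]
  have hl : 0 < Real.log v := Real.log_pos (by linarith)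
  refine div_le_div_of_nonneg_right ?_ (by positivity)
  have hβ := nicolasBeta_lt'
  have hβ0 : 0 < nicolasBeta := by linarith [nicolasBeta_gt]
  have hL := log_two_pi_lt
  have hs : 0 ≤ Real.sqrt v := Real.sqrt_nonneg v
  have he : 1 / (2 * (v ^ 2 - 1)) ≤ 1 / 240 :=
    one_div_le_one_div_of_le (by norm_num) (by nlinarith)
  nlinarith

/-! ### §3 `J(t) = ∫₂ᵗ (θ(u) − u)/(u log² u) du ≤ 1.88 + (0.132/log t + 0.55/log² t)√t` for `t ≥ 358801`, under RH -/

/-- The constants at `ξ = 11` of Schoenfeld's majorant: `B(11)w(11) ≤ 0.348`, `2β c₁₁ ≤ 0.0303`,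
`(log 2π + ε₁₁) a₁₁ ≤ 1.089` (`c_ξ = 1/log²ξ + 2/log³ξ`, `a_ξ = 1/log ξ + 1/log²ξ`, `ε_ξ = 1/(2(ξ²−1))`;
`log 11 > 2.3978952`, `β < 0.0474`, `log 2π < 1.8379`). [folklore] -/
private theorem schoenfeld_consts_eleven :
    Bmaj 11 * wt 11 ≤ 0.348 ∧
    2 * nicolasBeta * ((Real.log 11 ^ 2)⁻¹ + 2 * (Real.log 11 ^ 3)⁻¹) ≤ 0.0303 ∧
    (Real.log (2 * π) + (2 * ((11 : ℝ) ^ 2 - 1))⁻¹) * ((Real.log 11)⁻¹ + (Real.log 11 ^ 2)⁻¹) ≤ 1.089 := by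
  have hl11 := log_eleven_gt
  have hβ := nicolasBeta_lt'
  have hβ0 : 0 < nicolasBeta := by linarith [nicolasBeta_gt]
  have hL2π := log_two_pi_lt
  have hL2π0 := log_two_pi_pos
  have hl11_0 : 0 < Real.log 11 := by linarith
  have hl2 : 5.7499 ≤ Real.log 11 ^ 2 := by nlinarith
  have hi1 : (Real.log 11)⁻¹ ≤ 0.41704 := by
    rw [inv_le_comm₀ hl11_0 (by norm_num)]; linarith
  have hi2 : (Real.log 11 ^ 2)⁻¹ ≤ 0.17392 := by
    rw [inv_le_comm₀ (by positivity) (by norm_num)]; linarith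
  have hi3 : (Real.log 11 ^ 3)⁻¹ ≤ 0.0726 := by
    rw [inv_le_comm₀ (by positivity) (by norm_num)]; nlinarith
  refine ⟨?_, ?_, ?_⟩
  · have h := Bmaj_mul_wt_le (le_refl (11 : ℝ))
    have hs11 : Real.sqrt 11 ≤ 3.3167 := by
      rw [show (3.3167 : ℝ) = Real.sqrt (3.3167 ^ 2) by rw [Real.sqrt_sq (by norm_num)]]
      exact Real.sqrt_le_sqrt (by norm_num)
    calc Bmaj 11 * wt 11 ≤ (0.0474 * Real.sqrt 11 + 1.8421) / Real.log 11 ^ 2 := h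
      _ ≤ (0.0474 * 3.3167 + 1.8421) / 5.7499 :=
          div_le_div₀ (by positivity) (by linarith) (by norm_num) hl2
      _ ≤ 0.348 := by norm_num
  · have hc0 : 0 ≤ (Real.log 11 ^ 2)⁻¹ + 2 * (Real.log 11 ^ 3)⁻¹ := by positivity
    have hc : (Real.log 11 ^ 2)⁻¹ + 2 * (Real.log 11 ^ 3)⁻¹ ≤ 0.31912 := by linarith
    calc 2 * nicolasBeta * ((Real.log 11 ^ 2)⁻¹ + 2 * (Real.log 11 ^ 3)⁻¹)
        ≤ 2 * 0.0474 * 0.31912 := by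
          refine mul_le_mul (by linarith) hc hc0 (by norm_num)
      _ ≤ 0.0303 := by norm_num
  · have h1 : Real.log (2 * π) + (2 * ((11 : ℝ) ^ 2 - 1))⁻¹ ≤ 1.8421 := by norm_num; linarith
    have h2 : (Real.log 11)⁻¹ + (Real.log 11 ^ 2)⁻¹ ≤ 0.59096 := by linarith
    have h20 : 0 ≤ (Real.log 11)⁻¹ + (Real.log 11 ^ 2)⁻¹ := by positivity
    calc (Real.log (2 * π) + (2 * ((11 : ℝ) ^ 2 - 1))⁻¹) * ((Real.log 11)⁻¹ + (Real.log 11 ^ 2)⁻¹)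
        ≤ 1.8421 * 0.59096 := mul_le_mul h1 h2 h20 (by norm_num)
      _ ≤ 1.089 := by norm_num

/-- **Explicit one-sided Lemma 6 under RH**: for `t ≥ 358801 = 599²`,
`J(t) = ∫₂ᵗ (θ(u) − u)/(u log² u) du ≤ 1.88 + (0.132/log t + 0.55/log² t) √t`.
Route: `J(t) = J(11) + ∫_{11}^{√t} + ∫_{√t}^{t}`, `J(11) ≤ 0`; on each of the last two pieces
`∫ (θ − u) w ≤ ∫ (ψ − u) w ≤ |∫ (ψ − u) w|` (`θ ≤ ψ`) and Schoenfeld's integration by parts against `ψ₁`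
(`SchoenfeldBound.abs_integral_psi_sub_mul_w_le`, twice: on `[11, √t]` and on `[√t, t]`), then
`β < 0.0474`, `log 2π < 1.8379`, `log 11 > 2.3978952`, `log t ≥ 12.79` and `t^{1/4} log t ≤ 4√t`.
(The source's Lemma 6: `J(x) < (B₁ − 1.96)√x/log² x` for `x ≥ 10⁸`, with the tables of [RS] below `10⁸`.)
[cite: Zhao2025MertensMean, §2 (Lemma 6)] -/
theorem J_le_explicit_of_RH (hRH : RiemannHypothesis) {t : ℝ} (ht : 358801 ≤ t) :
    ∫ u in (2 : ℝ)..t, (θ u - u) / (u * Real.log u ^ 2) ≤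
      1.88 + (0.132 / Real.log t + 0.55 / Real.log t ^ 2) * Real.sqrt t := by
  obtain ⟨hBw11, hc11, ha11⟩ := schoenfeld_consts_eleven
  have hβ := nicolasBeta_lt'
  have hβ0 : 0 < nicolasBeta := by linarith only [nicolasBeta_gt]
  have hL2π := log_two_pi_lt
  have hL2π0 := log_two_pi_pos
  set r := Real.sqrt t with hr
  set ℓ := Real.log t with hℓ
  set q := Real.sqrt r with hq
  have ht0 : 0 < t := by linarith only [ht]
  have ht1 : 1 < t := by linarith only [ht]
  have hr599 : 599 ≤ r := by
    rw [hr, show (599 : ℝ) = Real.sqrt (599 ^ 2) by rw [Real.sqrt_sq (by norm_num)]]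
    exact Real.sqrt_le_sqrt (by norm_num; linarith only [ht])
  have hr0 : 0 < r := by linarith only [hr599]
  have hr11 : (11 : ℝ) ≤ r := by linarith only [hr599]
  have hrr : r * r = t := by rw [hr]; exact Real.mul_self_sqrt ht0.le
  have hrt : r ≤ t := by nlinarith only [hrr, hr599]
  have hq0 : 0 ≤ q := Real.sqrt_nonneg r
  have hq_pos : 0 < q := Real.sqrt_pos.2 hr0
  have hqq : q * q = r := by rw [hq]; exact Real.mul_self_sqrt hr0.le
  have hℓ1 : 12.79 ≤ ℓ := by
    have h1 := log_X₁_gt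
    have h2 : Real.log 358801 ≤ ℓ := Real.log_le_log (by norm_num) ht
    linarith only [h1, h2]
  have hℓ0 : 0 < ℓ := by linarith only [hℓ1]
  have hlogr : Real.log r = ℓ / 2 := by rw [hr, Real.log_sqrt ht0.le]
  have hlogq : Real.log q = ℓ / 4 := by rw [hq, Real.log_sqrt hr0.le, hlogr]; ring
  -- `q ℓ ≤ 4 r` (`ℓ = 4 log q ≤ 4(q − 1)`)
  have hqℓ : q * ℓ ≤ 4 * r := by
    have h1 : Real.log q ≤ q - 1 := Real.log_le_sub_one_of_pos hq_pos
    rw [hlogq] at h1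
    have h2 : ℓ ≤ 4 * q := by linarith only [h1]
    calc q * ℓ ≤ q * (4 * q) := mul_le_mul_of_nonneg_left h2 hq0
      _ = 4 * r := by rw [← hqq]; ring
  -- the atoms
  set a1 := r / ℓ with ha1
  set a2 := r / ℓ ^ 2 with ha2
  set a3 := r / ℓ ^ 3 with ha3
  set b1 := 1 / ℓ with hb1
  set b2 := 1 / ℓ ^ 2 with hb2
  set cq := q / ℓ ^ 2 with hcq
  have ha1_0 : 0 ≤ a1 := by positivity
  have ha2_0 : 0 ≤ a2 := by positivity
  have ha3_0 : 0 ≤ a3 := by positivity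
  have hb1_0 : 0 ≤ b1 := by positivity
  have hb2_0 : 0 ≤ b2 := by positivity
  have hcq_0 : 0 ≤ cq := by positivity
  have hb1_le : b1 ≤ 0.0782 := by
    rw [hb1, div_le_iff₀ hℓ0]; nlinarith only [hℓ1]
  have hb2_le : b2 ≤ 0.00612 := by
    rw [hb2, div_le_iff₀ (by positivity)]; nlinarith only [hℓ1]
  have hcq_le : cq ≤ 0.00612 * q := by
    have e : cq = q * b2 := by rw [hcq, hb2]; ring
    rw [e, mul_comm]
    exact mul_le_mul_of_nonneg_right hb2_le hq0
  have ha3_le : a3 ≤ 0.0782 * a2 := by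
    have e : a3 = b1 * a2 := by rw [ha3, hb1, ha2]; field_simp
    rw [e]
    exact mul_le_mul_of_nonneg_right hb1_le ha2_0
  have hq_le : q ≤ 4 * a1 := by
    rw [ha1, mul_div_assoc', le_div_iff₀ hℓ0]; linarith only [hqℓ]
  -- splitting `J(t)`
  have hI : ∀ x : ℝ, 1 < x →
      IntervalIntegrable (fun u : ℝ => (θ u - u) / (u * Real.log u ^ 2)) volume 2 x :=
    fun x hx => VonKochTransfer.intervalIntegrable_theta_sub_div hx
  have h2_11 := hI 11 (by norm_num)
  have h2_r := hI r (by linarith only [hr599])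
  have h2_t := hI t ht1
  have h11_r := h2_11.symm.trans h2_r
  have hr_t := h2_r.symm.trans h2_t
  rw [← intervalIntegral.integral_add_adjacent_intervals h2_11 (h11_r.trans hr_t),
    ← intervalIntegral.integral_add_adjacent_intervals h11_r hr_t]
  have hP1 := J_eleven_nonpos
  -- piece `[11, r]`
  have hP2 : ∫ u in (11 : ℝ)..r, (θ u - u) / (u * Real.log u ^ 2) ≤
      Bmaj r * wt r + Bmaj 11 * wt 11 +
        2 * nicolasBeta * ((Real.log 11 ^ 2)⁻¹ + 2 * (Real.log 11 ^ 3)⁻¹) * (q - Real.sqrt 11) +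
        (Real.log (2 * π) + (2 * ((11 : ℝ) ^ 2 - 1))⁻¹) * ((Real.log 11)⁻¹ + (Real.log 11 ^ 2)⁻¹) := by
    rw [integral_theta_sub_eq (by norm_num : (1 : ℝ) < 11) hr11]
    have hnn : 0 ≤ ∫ u in (11 : ℝ)..r, (ψ u - θ u) * wt u :=
      intervalIntegral.integral_nonneg hr11 fun u hu =>
        mul_nonneg (sub_nonneg.2 (Chebyshev.theta_le_psi u)) (wt_pos (by linarith only [hu.1])).le
    have habs := abs_integral_psi_sub_mul_w_le hRH (by norm_num : (2 : ℝ) ≤ 11) hr11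
    rw [← hq] at habs
    linarith only [hnn, habs, le_abs_self (∫ u in (11 : ℝ)..r, (ψ u - u) * wt u)]
  -- piece `[r, t]`
  have hP3 : ∫ u in r..t, (θ u - u) / (u * Real.log u ^ 2) ≤
      Bmaj t * wt t + Bmaj r * wt r +
        2 * nicolasBeta * ((Real.log r ^ 2)⁻¹ + 2 * (Real.log r ^ 3)⁻¹) * (r - q) +
        (Real.log (2 * π) + (2 * (r ^ 2 - 1))⁻¹) * ((Real.log r)⁻¹ + (Real.log r ^ 2)⁻¹) := by
    rw [integral_theta_sub_eq (by linarith only [hr599] : (1 : ℝ) < r) hrt]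
    have hnn : 0 ≤ ∫ u in r..t, (ψ u - θ u) * wt u :=
      intervalIntegral.integral_nonneg hrt fun u hu =>
        mul_nonneg (sub_nonneg.2 (Chebyshev.theta_le_psi u)) (wt_pos (by linarith only [hu.1, hr599])).le
    have habs := abs_integral_psi_sub_mul_w_le hRH (by linarith only [hr599] : (2 : ℝ) ≤ r) hrt
    rw [← hr, ← hq] at habs
    linarith only [hnn, habs, le_abs_self (∫ u in r..t, (ψ u - u) * wt u)]
  rw [hlogr] at hP3
  -- the terms, one by one
  have hT2a : 2 * nicolasBeta * ((Real.log 11 ^ 2)⁻¹ + 2 * (Real.log 11 ^ 3)⁻¹) * (q - Real.sqrt 11) ≤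
      0.0303 * q := by
    have hc0' : 0 ≤ 2 * nicolasBeta * ((Real.log 11 ^ 2)⁻¹ + 2 * (Real.log 11 ^ 3)⁻¹) := by
      have : 0 < Real.log 11 := by linarith only [log_eleven_gt]
      positivity
    have hs : 0 ≤ Real.sqrt 11 := Real.sqrt_nonneg 11
    calc 2 * nicolasBeta * ((Real.log 11 ^ 2)⁻¹ + 2 * (Real.log 11 ^ 3)⁻¹) * (q - Real.sqrt 11)
        ≤ 2 * nicolasBeta * ((Real.log 11 ^ 2)⁻¹ + 2 * (Real.log 11 ^ 3)⁻¹) * q :=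
          mul_le_mul_of_nonneg_left (by linarith only [hs]) hc0'
      _ ≤ 0.0303 * q := mul_le_mul_of_nonneg_right hc11 hq0
  have hBwr : Bmaj r * wt r ≤ 0.1896 * cq + 7.3684 * b2 := by
    have h := Bmaj_mul_wt_le hr11
    rw [← hq, hlogr] at h
    have e : (0.0474 * q + 1.8421) / (ℓ / 2) ^ 2 = 0.1896 * cq + 7.3684 * b2 := by
      rw [hcq, hb2]; field_simp; ring
    linarith only [h, e]
  have hBwt : Bmaj t * wt t ≤ 0.0474 * a2 + 1.8421 * b2 := by
    have h := Bmaj_mul_wt_le (show (11 : ℝ) ≤ t by linarith only [ht])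
    rw [← hr, ← hℓ] at h
    have e : (0.0474 * r + 1.8421) / ℓ ^ 2 = 0.0474 * a2 + 1.8421 * b2 := by
      rw [ha2, hb2]; field_simp
    linarith only [h, e]
  have hT3a : 2 * nicolasBeta * (((ℓ / 2) ^ 2)⁻¹ + 2 * ((ℓ / 2) ^ 3)⁻¹) * (r - q) ≤
      0.3792 * a2 + 1.5168 * a3 := by
    have eC : (((ℓ / 2) ^ 2)⁻¹ + 2 * ((ℓ / 2) ^ 3)⁻¹) * r = 4 * a2 + 16 * a3 := by
      rw [ha2, ha3]; field_simp; ring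
    have h0 : 0 ≤ 2 * nicolasBeta * (((ℓ / 2) ^ 2)⁻¹ + 2 * ((ℓ / 2) ^ 3)⁻¹) := by positivity
    have h4 : 0 ≤ 4 * a2 + 16 * a3 := by positivity
    calc 2 * nicolasBeta * (((ℓ / 2) ^ 2)⁻¹ + 2 * ((ℓ / 2) ^ 3)⁻¹) * (r - q)
        ≤ 2 * nicolasBeta * (((ℓ / 2) ^ 2)⁻¹ + 2 * ((ℓ / 2) ^ 3)⁻¹) * r :=
          mul_le_mul_of_nonneg_left (by linarith only [hq0]) h0
      _ = 2 * nicolasBeta * (4 * a2 + 16 * a3) := by rw [mul_assoc, eC]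
      _ ≤ 2 * 0.0474 * (4 * a2 + 16 * a3) :=
          mul_le_mul_of_nonneg_right (by linarith only [hβ]) h4
      _ = 0.3792 * a2 + 1.5168 * a3 := by ring
  have hT3b : (Real.log (2 * π) + (2 * (r ^ 2 - 1))⁻¹) * ((ℓ / 2)⁻¹ + ((ℓ / 2) ^ 2)⁻¹) ≤
      3.6842 * b1 + 7.3684 * b2 := by
    have hr2 : (240 : ℝ) ≤ 2 * (r ^ 2 - 1) := by nlinarith only [hr11]
    have he : (2 * (r ^ 2 - 1))⁻¹ ≤ (240 : ℝ)⁻¹ := inv_anti₀ (by norm_num) hr2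
    have h1 : Real.log (2 * π) + (2 * (r ^ 2 - 1))⁻¹ ≤ 1.8421 := by
      norm_num at he ⊢; linarith only [he, hL2π]
    have e2 : (ℓ / 2)⁻¹ + ((ℓ / 2) ^ 2)⁻¹ = 2 * b1 + 4 * b2 := by rw [hb1, hb2]; field_simp; ring
    rw [e2]
    have h20 : 0 ≤ 2 * b1 + 4 * b2 := by positivity
    calc (Real.log (2 * π) + (2 * (r ^ 2 - 1))⁻¹) * (2 * b1 + 4 * b2) ≤ 1.8421 * (2 * b1 + 4 * b2) :=
          mul_le_mul_of_nonneg_right h1 h20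
      _ = 3.6842 * b1 + 7.3684 * b2 := by ring
  -- assemble
  have e : (0.132 / ℓ + 0.55 / ℓ ^ 2) * r = 0.132 * a1 + 0.55 * a2 := by rw [ha1, ha2]; ring
  rw [e]
  linarith only [hP1, hP2, hP3, hBw11, ha11, hT2a, hBwr, hBwt, hT3a, hT3b, hb1_le, hb2_le, hcq_le, ha3_le,
    hq_le, ha1_0, ha2_0, ha3_0, hb1_0, hb2_0, hcq_0, hq0]

/-! ### §4 RH-free Chebyshev inputs: `ψ − θ ≥ 0.86√t` (`t ≥ 358801`) and an upper majorant of `∫_u^∞ (ψ − θ)/v²` -/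

/-- `log 599 < 6.39527` (`KernelLog.logIv 599`, evaluated by the kernel). [folklore] -/
private theorem log_599_lt : Real.log 599 < 6.39527 := by
  have h := KernelLog.logIv_sound (n := 599) (lo := 7731396869151445015616820)
    (hi := 7731396869151920621729654) (by decide +kernel)
  have e : ((599 : ℕ) : ℝ) = 599 := by norm_num
  rw [e] at h
  have : ((7731396869151920621729654 : ℤ) : ℝ) / 2 ^ 80 < 6.39527 := by norm_num
  linarith [h.2]

/-- **`ψ(t) − θ(t) ≥ 0.86 √t` for `t ≥ 358801 = 599²`, RH-free** (`ψ − θ ≥ ψ(√t)`, Mathlib; Chebyshev's explicit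
`ψ(n) ≥ A n − 5 log n`, `A ≥ 0.921292`, `n ≥ 30`, the tree's `ChebyshevExplicit.psi_ge_chebyshev`; `log s ≤ log 599 + s/599 − 1`).
The source uses Rosser–Schoenfeld's `ψ − θ > 0.98√x` (`x ≥ 121`). [cite: Zhao2025MertensMean, §2 (2.2)] -/
theorem psi_sub_theta_ge_086 {t : ℝ} (ht : 358801 ≤ t) : 0.86 * Real.sqrt t ≤ ψ t - θ t := by
  have ht0 : 0 ≤ t := by linarith
  set s := Real.sqrt t with hs
  have hs599 : 599 ≤ s := by
    rw [hs, show (599 : ℝ) = Real.sqrt (599 ^ 2) by rw [Real.sqrt_sq (by norm_num)]]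
    exact Real.sqrt_le_sqrt (by norm_num; linarith)
  have hs0 : 0 < s := by linarith
  -- `ψ(√t) ≤ ψ(t) − θ(t)`
  have h1 := Chebyshev.psi_sub_theta_ge_psi_add_psi_add_psi ht0
  have e : t ^ (2 : ℝ)⁻¹ = s := by rw [hs, Real.sqrt_eq_rpow]; norm_num
  rw [e] at h1
  have h3 : 0 ≤ ψ (t ^ (3 : ℝ)⁻¹) := Chebyshev.psi_nonneg _
  have h7 : 0 ≤ ψ (t ^ (7 : ℝ)⁻¹) := Chebyshev.psi_nonneg _
  -- Chebyshev at `n = ⌊s⌋`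
  set n := ⌊s⌋₊ with hn
  have hn599 : 599 ≤ n := Nat.le_floor (by simpa using hs599)
  have hns : (n : ℝ) ≤ s := Nat.floor_le hs0.le
  have hsn : s < n + 1 := Nat.lt_floor_add_one s
  have hn0 : (0 : ℝ) < n := by exact_mod_cast (show 0 < n by omega)
  have hψ : ψ s = ψ (n : ℝ) := Chebyshev.psi_eq_psi_coe_floor s
  have hcheb := ChebyshevExplicit.psi_ge_chebyshev (n := n) (by omega)
  have hA := ChebyshevExplicit.A_bounds
  have hAn : 0.921292 * (n : ℝ) ≤ ChebyshevExplicit.A * n := mul_le_mul_of_nonneg_right hA.1 hn0.le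
  have hlogn : Real.log n ≤ Real.log s := Real.log_le_log hn0 hns
  -- `log s ≤ log 599 + s/599 − 1`
  have hlogs : Real.log s ≤ 5.39527 + s / 599 := by
    have h := Real.log_le_sub_one_of_pos (show 0 < s / 599 by positivity)
    rw [Real.log_div hs0.ne' (by norm_num)] at h
    linarith [log_599_lt]
  rw [hψ] at h1
  linarith

/-- Chebyshev's upper bound on the reals: `ψ(y) ≤ 1.1056 y + 3 log² y + 80` for `y ≥ 1`
(`ChebyshevExplicit.psi_le_chebyshev` at `⌊y⌋`, `6A/5 ≤ 1.1056`). [cite: Zhao2025MertensMean, §2 (proof of Cor 1, the bound for ψ − θ)] -/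
theorem psi_le_explicit {y : ℝ} (hy : 1 ≤ y) : ψ y ≤ 1.1056 * y + 3 * Real.log y ^ 2 + 80 := by
  set n := ⌊y⌋₊ with hn
  have hn1 : 1 ≤ n := Nat.le_floor (by simpa using hy)
  have hny : (n : ℝ) ≤ y := Nat.floor_le (by linarith)
  have hn0 : (0 : ℝ) < n := by exact_mod_cast (show 0 < n by omega)
  rw [Chebyshev.psi_eq_psi_coe_floor]
  have h := ChebyshevExplicit.psi_le_chebyshev n
  have hA := ChebyshevExplicit.A_bounds
  have hlog : Real.log n ≤ Real.log y := Real.log_le_log hn0 hny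
  have hlog0 : 0 ≤ Real.log n := Real.log_nonneg (by exact_mod_cast hn1)
  have hlog2 : Real.log n ^ 2 ≤ Real.log y ^ 2 := pow_le_pow_left₀ hlog0 hlog 2
  have hAn : 6 / 5 * ChebyshevExplicit.A * n ≤ 1.1056 * n := by
    refine mul_le_mul_of_nonneg_right ?_ hn0.le
    linarith [hA.2]
  linarith

/-- `ψ(y) ≤ 5.3863 y` for `y ≥ 0` (Mathlib's `ψ ≤ (log 4 + 4) y`). [folklore] -/
private theorem psi_le_crude {y : ℝ} (hy : 0 ≤ y) : ψ y ≤ 5.3863 * y := by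
  have h := Chebyshev.psi_le_const_mul_self hy
  have hl4 : Real.log 4 = 2 * Real.log 2 := by
    rw [show (4 : ℝ) = 2 ^ 2 by norm_num, Real.log_pow]; norm_num
  have hl2 := Real.log_two_lt_d9
  rw [hl4] at h
  nlinarith

/-- **An explicit majorant of `∫_u^∞ (ψ − θ)/v²`, RH-free**: for `u ≥ 358801`,
`∫_u^∞ (ψ(v) − θ(v)) v⁻² dv ≤ 2.2112 u^{-1/2} + 16.159 u^{-2/3} + (1.5 log² u + 128)/u`
(`ψ − θ ≤ ψ(v^{1/2}) + ψ(v^{1/3}) + ψ(v^{1/5})`, Mathlib; Chebyshev's `ψ(y) ≤ 1.1056y + 3log²y + 80` at `√v`,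
`ψ(y) ≤ 5.39y` at `v^{1/3}, v^{1/5}`; `log² v ≤ 2 log² u + 32√(v/u)`). The source uses `ψ − θ < 1.001093√x + 3x^{1/3}`
[RS]. [cite: Zhao2025MertensMean, §2 (proof of Cor 1, the bound for ψ − θ)] -/
theorem integral_psi_sub_theta_div_sq_le_explicit {u : ℝ} (hu : 358801 ≤ u) :
    ∫ v in Ioi u, (ψ v - θ v) / v ^ 2 ≤
      2.2112 * u ^ (-(1 / 2 : ℝ)) + 16.159 * u ^ (-(2 / 3 : ℝ)) + (1.5 * Real.log u ^ 2 + 128) * u⁻¹ := by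
  have hu0 : 0 < u := by linarith
  have hu1 : 1 ≤ u := by linarith
  set Lu := Real.log u with hLu
  have hLu0 : 0 < Lu := Real.log_pos (by linarith)
  set su := Real.sqrt u with hsu
  have hsu0 : 0 < su := Real.sqrt_pos.2 hu0
  -- the majorant
  set m : ℝ → ℝ := fun v => (1.1056 + 24 / su) * v ^ (-(3 / 2 : ℝ)) + 10.7726 * v ^ (-(5 / 3 : ℝ)) +
    (1.5 * Lu ^ 2 + 80) * v ^ (-(2 : ℝ)) with hm
  have hi32 := integrableOn_Ioi_rpow_of_lt (by norm_num : (-(3 / 2 : ℝ)) < -1) hu0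
  have hi53 := integrableOn_Ioi_rpow_of_lt (by norm_num : (-(5 / 3 : ℝ)) < -1) hu0
  have hi2 := integrableOn_Ioi_rpow_of_lt (by norm_num : (-(2 : ℝ)) < -1) hu0
  have hiA : Integrable (fun v : ℝ => (1.1056 + 24 / su) * v ^ (-(3 / 2 : ℝ)) + 10.7726 * v ^ (-(5 / 3 : ℝ)))
      (volume.restrict (Ioi u)) := (hi32.const_mul _).add (hi53.const_mul _)
  have hiB : Integrable (fun v : ℝ => (1.5 * Lu ^ 2 + 80) * v ^ (-(2 : ℝ))) (volume.restrict (Ioi u)) :=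
    hi2.const_mul _
  have hmi : IntegrableOn m (Ioi u) := hiA.add hiB
  have hmval : ∫ v in Ioi u, m v = (1.1056 + 24 / su) * (2 * u ^ (-(1 / 2 : ℝ))) +
      10.7726 * (3 / 2 * u ^ (-(2 / 3 : ℝ))) + (1.5 * Lu ^ 2 + 80) * u ^ (-(1 : ℝ)) := by
    simp only [hm]
    rw [integral_add hiA hiB, integral_add (hi32.const_mul _) (hi53.const_mul _), integral_const_mul,
      integral_const_mul, integral_const_mul, integral_Ioi_rpow_of_lt (by norm_num) hu0,
      integral_Ioi_rpow_of_lt (by norm_num) hu0, integral_Ioi_rpow_of_lt (by norm_num) hu0]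
    norm_num
    ring
  -- pointwise
  have hpt : ∀ v ∈ Ioi u, (ψ v - θ v) / v ^ 2 ≤ m v := by
    intro v hv
    have huv : u < v := hv
    have hv0 : 0 < v := hu0.trans huv
    have hv1 : 1 ≤ v := hu1.trans huv.le
    -- the three `ψ`
    have h3ψ := Chebyshev.psi_sub_theta_le_psi_add_psi_add_psi v
    have hsv : v ^ (2 : ℝ)⁻¹ = Real.sqrt v := by rw [Real.sqrt_eq_rpow]; norm_num
    rw [hsv] at h3ψ
    have hsqv1 : 1 ≤ Real.sqrt v := by
      rw [show (1 : ℝ) = Real.sqrt 1 by simp]; exact Real.sqrt_le_sqrt hv1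
    have hA := psi_le_explicit hsqv1
    rw [Real.log_sqrt hv0.le] at hA
    have h13 : 0 ≤ v ^ (3 : ℝ)⁻¹ := Real.rpow_nonneg hv0.le _
    have hB := psi_le_crude h13
    have hC : ψ (v ^ (5 : ℝ)⁻¹) ≤ 5.3863 * v ^ (3 : ℝ)⁻¹ := by
      have h15 : v ^ (5 : ℝ)⁻¹ ≤ v ^ (3 : ℝ)⁻¹ := Real.rpow_le_rpow_of_exponent_le hv1 (by norm_num)
      exact (Chebyshev.psi_mono h15).trans hB
    -- `log² v ≤ 2 log² u + 32 √v/√u`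
    have hlog : Real.log v ^ 2 ≤ 2 * Lu ^ 2 + 32 * (Real.sqrt v / su) := by
      have hd : Real.log v = Lu + Real.log (v / u) := by
        rw [Real.log_div hv0.ne' hu0.ne']; ring
      have hd0 : 0 ≤ Real.log (v / u) := Real.log_nonneg (by rw [le_div_iff₀ hu0]; linarith)
      have hd1 : Real.log (v / u) ≤ (v / u) ^ (1 / 4 : ℝ) / (1 / 4) :=
        Real.log_le_rpow_div (by positivity) (by norm_num)
      have hq : ((v / u) ^ (1 / 4 : ℝ)) ^ 2 = Real.sqrt v / su := by
        rw [← Real.rpow_natCast, ← Real.rpow_mul (by positivity), hsu, Real.sqrt_eq_rpow, Real.sqrt_eq_rpow,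
          Real.div_rpow hv0.le hu0.le]
        norm_num
      have hd2 : Real.log (v / u) ^ 2 ≤ 16 * (Real.sqrt v / su) := by
        rw [← hq]
        have : Real.log (v / u) ≤ 4 * (v / u) ^ (1 / 4 : ℝ) := by linarith
        nlinarith [Real.rpow_nonneg (show 0 ≤ v / u by positivity) (1 / 4 : ℝ)]
      rw [hd]
      nlinarith [sq_nonneg (Lu - Real.log (v / u))]
    -- assemble the numerator
    have hnum : ψ v - θ v ≤ (1.1056 + 24 / su) * Real.sqrt v + 10.7726 * v ^ (3 : ℝ)⁻¹ + (1.5 * Lu ^ 2 + 80) := by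
      have e : (1.1056 + 24 / su) * Real.sqrt v = 1.1056 * Real.sqrt v + 24 * (Real.sqrt v / su) := by ring
      rw [e]
      have : 3 * (Real.log v / 2) ^ 2 = 0.75 * Real.log v ^ 2 := by ring
      rw [this] at hA
      linarith
    have hv2 : 0 < v ^ 2 := by positivity
    have e32 : Real.sqrt v / v ^ 2 = v ^ (-(3 / 2 : ℝ)) := by
      rw [Real.sqrt_eq_rpow, show (-(3 / 2 : ℝ)) = 1 / 2 - 2 by norm_num, Real.rpow_sub hv0, Real.rpow_two]
    have e53 : v ^ (3 : ℝ)⁻¹ / v ^ 2 = v ^ (-(5 / 3 : ℝ)) := by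
      rw [show (-(5 / 3 : ℝ)) = (3 : ℝ)⁻¹ - 2 by norm_num, Real.rpow_sub hv0, Real.rpow_two]
    have e2 : (1 : ℝ) / v ^ 2 = v ^ (-(2 : ℝ)) := by
      rw [Real.rpow_neg hv0.le, Real.rpow_two, one_div]
    calc (ψ v - θ v) / v ^ 2
        ≤ ((1.1056 + 24 / su) * Real.sqrt v + 10.7726 * v ^ (3 : ℝ)⁻¹ + (1.5 * Lu ^ 2 + 80)) / v ^ 2 :=
          div_le_div_of_nonneg_right hnum hv2.le
      _ = m v := by
          rw [hm]; simp only
          rw [← e32, ← e53, ← e2]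
          field_simp
  -- integrate
  have hmono := setIntegral_mono_on
    (RosserSchoenfeld.integrableOn_psi_sub_theta_div_sq.mono_set (Ioi_subset_Ioi hu1)) hmi measurableSet_Ioi hpt
  refine hmono.trans ?_
  rw [hmval]
  -- simplify: `(24/√u)·2u^{-1/2} = 48/u`, `u^{-1} = u⁻¹`
  have e1 : u ^ (-(1 : ℝ)) = u⁻¹ := Real.rpow_neg_one u
  have e2 : 24 / su * (2 * u ^ (-(1 / 2 : ℝ))) = 48 * u⁻¹ := by
    rw [hsu, Real.sqrt_eq_rpow, Real.rpow_neg hu0.le]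
    have : (u ^ (1 / 2 : ℝ)) * (u ^ (1 / 2 : ℝ)) = u := by
      rw [← Real.rpow_add hu0]; norm_num
    have h0 : 0 < u ^ (1 / 2 : ℝ) := Real.rpow_pos_of_pos hu0 _
    field_simp
    nlinarith [this]
  rw [e1]
  have h23 : 0 ≤ u ^ (-(2 / 3 : ℝ)) := Real.rpow_nonneg hu0.le _
  nlinarith [e2, h23]

/-- **Under RH, an explicit lower bound for the `θ`-tail** (`u ≥ 358801`):
`∫_u^∞ (θ(t) − t) t⁻² dt ≥ −(β + 2.2112) u^{-1/2} − 16.159 u^{-2/3} − (1.5 log² u + 129.84)/u`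
(Rosser–Schoenfeld's Lemma 7, lower form, `K(u) = β u^{-1/2}` under RH, and `integral_psi_sub_theta_div_sq_le_explicit`).
[cite: Zhao2025MertensMean, §2 ((2.2)–(2.3))] -/
theorem tail_ge_explicit_of_RH (hRH : RiemannHypothesis) {u : ℝ} (hu : 358801 ≤ u) :
    -((nicolasBeta + 2.2112) * u ^ (-(1 / 2 : ℝ)) + 16.159 * u ^ (-(2 / 3 : ℝ)) +
        (1.5 * Real.log u ^ 2 + 129.84) * u⁻¹) ≤ ∫ t in Ioi u, (θ t - t) / t ^ 2 := by
  have hu0 : 0 < u := by linarith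
  have hu1 : 1 < u := by linarith
  rw [tail_eq_psi_sub hu1.le]
  have h1 := neg_integral_Ioi_psi_sub_self_div_sq_le hu1
  rw [rsK_eq_of_RH hRH hu0] at h1
  have h2 := integral_psi_sub_theta_div_sq_le_explicit hu
  have hl : Real.log (2 * π) / u ≤ 1.84 * u⁻¹ := by
    rw [div_eq_mul_inv]
    exact mul_le_mul_of_nonneg_right (by linarith [log_two_pi_lt]) (inv_nonneg.2 hu0.le)
  nlinarith [h1, h2, hl]

/-! ### §5 The three terms of `X · T₂(X)` under RH, `T₂(X) = ∫_X^∞ (π − li)/t²` (`piLiTail_eq`) -/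

/-- **Term A**: under RH, for `X ≥ 358801`, `X T(X)/log X ≤ ((β − 1.72)√X + 1)/log X`
(`mul_tail_le_of_RH'` with `κ = 0.86` from `psi_sub_theta_ge_086`). [cite: Zhao2025MertensMean, §2 ((2.2)–(2.3))] -/
theorem termA_le_of_RH (hRH : RiemannHypothesis) {X : ℝ} (hX : 358801 ≤ X) :
    X * ((∫ t in Ioi X, (θ t - t) / t ^ 2) * (Real.log X)⁻¹) ≤
      ((nicolasBeta - 1.72) * Real.sqrt X + 1) / Real.log X := by
  have hL : 0 < Real.log X := Real.log_pos (by linarith)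
  have h := mul_tail_le_of_RH' hRH (κ := 0.86) (y := X) (by linarith)
    (fun t ht => psi_sub_theta_ge_086 (hX.trans ht))
  rw [← mul_assoc, div_eq_mul_inv]
  refine mul_le_mul_of_nonneg_right ?_ (inv_nonneg.2 hL.le)
  linarith

/-- **Term B**: under RH, for `X ≥ 358801`,
`−X ∫_X^∞ T(t) dt/(t log² t) ≤ (4.5172√X + 24.24 X^{1/3} + 129.84)/log² X + 1.5` (`tail_ge_explicit_of_RH`
pointwise, `1/log² t ≤ 1/log² X`, and `∫_X^∞ t^{a} dt` in closed form). [cite: Zhao2025MertensMean, §2 (proof of Thm 1 for E₂)] -/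
theorem termB_le_of_RH (hRH : RiemannHypothesis) {X : ℝ} (hX : 358801 ≤ X) :
    -(X * ∫ t in Ioi X, (∫ u in Ioi t, (θ u - u) / u ^ 2) * (t⁻¹ / Real.log t ^ 2)) ≤
      (4.5172 * Real.sqrt X + 24.24 * X ^ (1 / 3 : ℝ) + 129.84) / Real.log X ^ 2 + 1.5 := by
  have hX0 : 0 < X := by linarith
  have hX2 : (2 : ℝ) ≤ X := by linarith
  set L := Real.log X with hL
  have hL0 : 0 < L := Real.log_pos (by linarith)
  have hβ := nicolasBeta_lt'
  have hβ0 : 0 < nicolasBeta := by linarith only [nicolasBeta_gt]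
  -- the majorant
  set mB : ℝ → ℝ := fun t => ((nicolasBeta + 2.2112) / L ^ 2) * t ^ (-(3 / 2 : ℝ)) +
    (16.159 / L ^ 2) * t ^ (-(5 / 3 : ℝ)) + (129.84 / L ^ 2 + 1.5) * t ^ (-(2 : ℝ)) with hmB
  have hi32 := integrableOn_Ioi_rpow_of_lt (by norm_num : (-(3 / 2 : ℝ)) < -1) hX0
  have hi53 := integrableOn_Ioi_rpow_of_lt (by norm_num : (-(5 / 3 : ℝ)) < -1) hX0
  have hi2 := integrableOn_Ioi_rpow_of_lt (by norm_num : (-(2 : ℝ)) < -1) hX0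
  have hiA : Integrable (fun t : ℝ => ((nicolasBeta + 2.2112) / L ^ 2) * t ^ (-(3 / 2 : ℝ)) +
      (16.159 / L ^ 2) * t ^ (-(5 / 3 : ℝ))) (volume.restrict (Ioi X)) := (hi32.const_mul _).add (hi53.const_mul _)
  have hiB : Integrable (fun t : ℝ => (129.84 / L ^ 2 + 1.5) * t ^ (-(2 : ℝ))) (volume.restrict (Ioi X)) :=
    hi2.const_mul _
  have hmi : IntegrableOn mB (Ioi X) := hiA.add hiB
  have hmval : ∫ t in Ioi X, mB t = ((nicolasBeta + 2.2112) / L ^ 2) * (2 * X ^ (-(1 / 2 : ℝ))) +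
      (16.159 / L ^ 2) * (3 / 2 * X ^ (-(2 / 3 : ℝ))) + (129.84 / L ^ 2 + 1.5) * X ^ (-(1 : ℝ)) := by
    simp only [hmB]
    rw [integral_add hiA hiB, integral_add (hi32.const_mul _) (hi53.const_mul _), integral_const_mul,
      integral_const_mul, integral_const_mul, integral_Ioi_rpow_of_lt (by norm_num) hX0,
      integral_Ioi_rpow_of_lt (by norm_num) hX0, integral_Ioi_rpow_of_lt (by norm_num) hX0]
    norm_num
    ring
  -- pointwise
  have hpt : ∀ t ∈ Ioi X, -((∫ u in Ioi t, (θ u - u) / u ^ 2) * (t⁻¹ / Real.log t ^ 2)) ≤ mB t := by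
    intro t ht
    have hXt : X < t := ht
    have ht1 : 358801 ≤ t := by linarith
    have ht0 : 0 < t := by linarith
    have hlt : L ≤ Real.log t := Real.log_le_log hX0 hXt.le
    have hlt0 : 0 < Real.log t := hL0.trans_le hlt
    have hT := tail_ge_explicit_of_RH hRH ht1
    set N₁ : ℝ := (nicolasBeta + 2.2112) * t ^ (-(1 / 2 : ℝ)) + 16.159 * t ^ (-(2 / 3 : ℝ)) + 129.84 * t⁻¹ with hN₁
    have hN₁0 : 0 ≤ N₁ := by positivity
    have hw0 : 0 ≤ t⁻¹ / Real.log t ^ 2 := by positivity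
    -- `−T(t) ≤ N₁ + 1.5 log² t / t`
    have hnegT : -(∫ u in Ioi t, (θ u - u) / u ^ 2) ≤ N₁ + 1.5 * Real.log t ^ 2 * t⁻¹ := by
      have e : (nicolasBeta + 2.2112) * t ^ (-(1 / 2 : ℝ)) + 16.159 * t ^ (-(2 / 3 : ℝ)) +
          (1.5 * Real.log t ^ 2 + 129.84) * t⁻¹ = N₁ + 1.5 * Real.log t ^ 2 * t⁻¹ := by rw [hN₁]; ring
      linarith
    rw [← neg_mul]
    calc -(∫ u in Ioi t, (θ u - u) / u ^ 2) * (t⁻¹ / Real.log t ^ 2)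
        ≤ (N₁ + 1.5 * Real.log t ^ 2 * t⁻¹) * (t⁻¹ / Real.log t ^ 2) := mul_le_mul_of_nonneg_right hnegT hw0
      _ = N₁ * t⁻¹ / Real.log t ^ 2 + 1.5 * (t⁻¹ * t⁻¹) := by field_simp
      _ ≤ N₁ * t⁻¹ / L ^ 2 + 1.5 * (t⁻¹ * t⁻¹) := by
          have : N₁ * t⁻¹ / Real.log t ^ 2 ≤ N₁ * t⁻¹ / L ^ 2 :=
            div_le_div_of_nonneg_left (by positivity) (by positivity) (pow_le_pow_left₀ hL0.le hlt 2)
          linarith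
      _ = mB t := by
          have p1 : t ^ (-(1 / 2 : ℝ)) * t⁻¹ = t ^ (-(3 / 2 : ℝ)) := by
            rw [← Real.rpow_neg_one, ← Real.rpow_add ht0]; norm_num
          have p2 : t ^ (-(2 / 3 : ℝ)) * t⁻¹ = t ^ (-(5 / 3 : ℝ)) := by
            rw [← Real.rpow_neg_one, ← Real.rpow_add ht0]; norm_num
          have p3 : t⁻¹ * t⁻¹ = t ^ (-(2 : ℝ)) := by
            rw [← Real.rpow_neg_one, ← Real.rpow_add ht0]; norm_num
          rw [hmB, hN₁]; simp only
          rw [← p1, ← p2, ← p3]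
          field_simp
          ring
  -- integrate
  have hTi := (integrableOn_tail_mul_inv_div_log_sq hX2).neg
  rw [← mul_neg, ← integral_neg]
  have hmono := setIntegral_mono_on hTi hmi measurableSet_Ioi hpt
  calc X * ∫ t in Ioi X, -((∫ u in Ioi t, (θ u - u) / u ^ 2) * (t⁻¹ / Real.log t ^ 2))
      ≤ X * ∫ t in Ioi X, mB t := mul_le_mul_of_nonneg_left hmono hX0.le
    _ = (2 * (nicolasBeta + 2.2112) * (X * X ^ (-(1 / 2 : ℝ))) + 16.159 * (3 / 2) * (X * X ^ (-(2 / 3 : ℝ))) +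
          129.84 * (X * X ^ (-(1 : ℝ)))) / L ^ 2 + 1.5 * (X * X ^ (-(1 : ℝ))) := by
        rw [hmval]; field_simp; ring
    _ = (2 * (nicolasBeta + 2.2112) * Real.sqrt X + 16.159 * (3 / 2) * X ^ (1 / 3 : ℝ) + 129.84) / L ^ 2 + 1.5 := by
        have q1 : X * X ^ (-(1 / 2 : ℝ)) = Real.sqrt X := by
          have e : X ^ (1 / 2 : ℝ) = X ^ ((1 : ℝ) + -(1 / 2)) := by norm_num
          rw [Real.sqrt_eq_rpow, e, Real.rpow_add hX0, Real.rpow_one]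
        have q2 : X * X ^ (-(2 / 3 : ℝ)) = X ^ (1 / 3 : ℝ) := by
          have e : X ^ (1 / 3 : ℝ) = X ^ ((1 : ℝ) + -(2 / 3)) := by norm_num
          rw [e, Real.rpow_add hX0, Real.rpow_one]
        have q3 : X * X ^ (-(1 : ℝ)) = 1 := by
          rw [Real.rpow_neg_one, mul_inv_cancel₀ hX0.ne']
        rw [q1, q2, q3]
        ring
    _ ≤ (4.5172 * Real.sqrt X + 24.24 * X ^ (1 / 3 : ℝ) + 129.84) / L ^ 2 + 1.5 := by
        have hs : 0 ≤ Real.sqrt X := Real.sqrt_nonneg X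
        have hc : 0 ≤ X ^ (1 / 3 : ℝ) := Real.rpow_nonneg hX0.le _
        have : 2 * (nicolasBeta + 2.2112) * Real.sqrt X + 16.159 * (3 / 2) * X ^ (1 / 3 : ℝ) + 129.84 ≤
            4.5172 * Real.sqrt X + 24.24 * X ^ (1 / 3 : ℝ) + 129.84 := by nlinarith
        have := div_le_div_of_nonneg_right this (by positivity : (0 : ℝ) ≤ L ^ 2)
        linarith

/-- **Term C**: under RH, for `X ≥ 358801`,
`X ∫_X^∞ [(π − li)/t² − (θ − t)/(t² log t)] dt = X ∫_X^∞ (J(t) + κ₀)/t² dt ≤ 1.88 + κ₀ + (0.264/log X + 1.1/log² X)√X`,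
`κ₀ = 2/log 2 − li(2)` ((2.6) and `J_le_explicit_of_RH`). [cite: Zhao2025MertensMean, §2 ((2.6), Lemma 6)] -/
theorem termC_le_of_RH (hRH : RiemannHypothesis) {X : ℝ} (hX : 358801 ≤ X) :
    X * ∫ t in Ioi X, (((Nat.primeCounting ⌊t⌋₊ : ℝ) - logIntegral t) / t ^ 2 -
        (θ t - t) / t ^ 2 * (Real.log t)⁻¹) ≤
      (1.88 + (2 / Real.log 2 - logIntegral 2)) + (0.264 / Real.log X + 1.1 / Real.log X ^ 2) * Real.sqrt X := by
  have hX0 : 0 < X := by linarith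
  have hX2 : (2 : ℝ) ≤ X := by linarith
  set L := Real.log X with hL
  have hL0 : 0 < L := Real.log_pos (by linarith)
  set κ₀ : ℝ := 2 / Real.log 2 - logIntegral 2 with hκ₀
  set cX : ℝ := 0.132 / L + 0.55 / L ^ 2 with hcX
  have hcX0 : 0 ≤ cX := by positivity
  -- the majorant
  set mC : ℝ → ℝ := fun t => (1.88 + κ₀) * t ^ (-(2 : ℝ)) + cX * t ^ (-(3 / 2 : ℝ)) with hmC
  have hi32 := integrableOn_Ioi_rpow_of_lt (by norm_num : (-(3 / 2 : ℝ)) < -1) hX0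
  have hi2 := integrableOn_Ioi_rpow_of_lt (by norm_num : (-(2 : ℝ)) < -1) hX0
  have hiA : Integrable (fun t : ℝ => (1.88 + κ₀) * t ^ (-(2 : ℝ))) (volume.restrict (Ioi X)) := hi2.const_mul _
  have hiB : Integrable (fun t : ℝ => cX * t ^ (-(3 / 2 : ℝ))) (volume.restrict (Ioi X)) := hi32.const_mul _
  have hmi : IntegrableOn mC (Ioi X) := hiA.add hiB
  have hmval : ∫ t in Ioi X, mC t = (1.88 + κ₀) * X ^ (-(1 : ℝ)) + cX * (2 * X ^ (-(1 / 2 : ℝ))) := by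
    simp only [hmC]
    rw [integral_add hiA hiB, integral_const_mul, integral_const_mul, integral_Ioi_rpow_of_lt (by norm_num) hX0,
      integral_Ioi_rpow_of_lt (by norm_num) hX0, show (-(2 : ℝ) + 1) = -1 by norm_num,
      show (-(3 / 2 : ℝ) + 1) = -(1 / 2) by norm_num]
    ring
  -- pointwise
  have hpt : ∀ t ∈ Ioi X, ((Nat.primeCounting ⌊t⌋₊ : ℝ) - logIntegral t) / t ^ 2 -
      (θ t - t) / t ^ 2 * (Real.log t)⁻¹ ≤ mC t := by
    intro t ht
    have hXt : X < t := ht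
    have ht1 : 358801 ≤ t := by linarith
    have ht0 : 0 < t := by linarith
    have hlt : L ≤ Real.log t := Real.log_le_log hX0 hXt.le
    have hlt0 : 0 < Real.log t := hL0.trans_le hlt
    rw [piLiKernel_sub_thetaKernel_div_log_eq (by linarith : (2 : ℝ) ≤ t)]
    have hJ := J_le_explicit_of_RH hRH ht1
    have hs0 : 0 ≤ Real.sqrt t := Real.sqrt_nonneg t
    have hct : 0.132 / Real.log t + 0.55 / Real.log t ^ 2 ≤ cX := by
      rw [hcX]
      gcongr
    have hnum : (∫ u in (2 : ℝ)..t, (θ u - u) / (u * Real.log u ^ 2)) + (2 / Real.log 2 - logIntegral 2) ≤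
        (1.88 + κ₀) + cX * Real.sqrt t := by
      have := mul_le_mul_of_nonneg_right hct hs0
      rw [hκ₀]; linarith
    have ht2 : 0 < t ^ 2 := by positivity
    have e32 : Real.sqrt t / t ^ 2 = t ^ (-(3 / 2 : ℝ)) := by
      rw [Real.sqrt_eq_rpow, show (-(3 / 2 : ℝ)) = 1 / 2 - 2 by norm_num, Real.rpow_sub ht0, Real.rpow_two]
    have e2 : (1 : ℝ) / t ^ 2 = t ^ (-(2 : ℝ)) := by
      rw [Real.rpow_neg ht0.le, Real.rpow_two, one_div]
    calc ((∫ u in (2 : ℝ)..t, (θ u - u) / (u * Real.log u ^ 2)) + (2 / Real.log 2 - logIntegral 2)) / t ^ 2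
        ≤ ((1.88 + κ₀) + cX * Real.sqrt t) / t ^ 2 := div_le_div_of_nonneg_right hnum ht2.le
      _ = mC t := by
          rw [hmC]; simp only
          rw [← e32, ← e2]
          field_simp
  -- integrate
  have hfi : IntegrableOn (fun t : ℝ => ((Nat.primeCounting ⌊t⌋₊ : ℝ) - logIntegral t) / t ^ 2 -
      (θ t - t) / t ^ 2 * (Real.log t)⁻¹) (Ioi X) :=
    (integrableOn_piLiKernel.mono_set (Ioi_subset_Ioi hX2)).sub (integrableOn_thetaKernel_mul_inv_log hX2)
  have hmono := setIntegral_mono_on hfi hmi measurableSet_Ioi hpt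
  calc X * ∫ t in Ioi X, (((Nat.primeCounting ⌊t⌋₊ : ℝ) - logIntegral t) / t ^ 2 -
        (θ t - t) / t ^ 2 * (Real.log t)⁻¹)
      ≤ X * ∫ t in Ioi X, mC t := mul_le_mul_of_nonneg_left hmono hX0.le
    _ = (1.88 + κ₀) * (X * X ^ (-(1 : ℝ))) + 2 * cX * (X * X ^ (-(1 / 2 : ℝ))) := by rw [hmval]; ring
    _ = (1.88 + κ₀) + (0.264 / L + 1.1 / L ^ 2) * Real.sqrt X := by
        have q1 : X * X ^ (-(1 / 2 : ℝ)) = Real.sqrt X := by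
          have e : X ^ (1 / 2 : ℝ) = X ^ ((1 : ℝ) + -(1 / 2)) := by norm_num
          rw [Real.sqrt_eq_rpow, e, Real.rpow_add hX0, Real.rpow_one]
        have q3 : X * X ^ (-(1 : ℝ)) = 1 := by
          rw [Real.rpow_neg_one, mul_inv_cancel₀ hX0.ne']
        rw [q1, q3, hcX]
        ring

/-! ### §6 Numerics of the assembly -/

/-- `18 log X ≤ √X` for `X ≥ 358801` (`w = X^{1/8} ≥ 4.946`, `log X = 8 log w ≤ 8(w − 1) ≤ w⁴/18`). [folklore] -/
private theorem eighteen_mul_log_le_sqrt {X : ℝ} (hX : 358801 ≤ X) : 18 * Real.log X ≤ Real.sqrt X := by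
  have hX0 : 0 < X := by linarith
  set s := Real.sqrt X with hs
  set v := Real.sqrt s with hv
  set w := Real.sqrt v with hw
  have hs599 : 599 ≤ s := by
    rw [hs, show (599 : ℝ) = Real.sqrt (599 ^ 2) by rw [Real.sqrt_sq (by norm_num)]]
    exact Real.sqrt_le_sqrt (by norm_num; linarith)
  have hs0 : 0 < s := by linarith
  have hv24 : 24.47 ≤ v := by
    rw [hv, show (24.47 : ℝ) = Real.sqrt (24.47 ^ 2) by rw [Real.sqrt_sq (by norm_num)]]
    exact Real.sqrt_le_sqrt (by norm_num; linarith)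
  have hv0 : 0 < v := by linarith
  have hw4 : 4.946 ≤ w := by
    rw [hw, show (4.946 : ℝ) = Real.sqrt (4.946 ^ 2) by rw [Real.sqrt_sq (by norm_num)]]
    exact Real.sqrt_le_sqrt (by norm_num; linarith)
  have hw0 : 0 < w := by linarith
  have hww : w * w = v := by rw [hw]; exact Real.mul_self_sqrt hv0.le
  have hvv : v * v = s := by rw [hv]; exact Real.mul_self_sqrt hs0.le
  have hlog : Real.log X = 8 * Real.log w := by
    rw [hw, Real.log_sqrt hv0.le, hv, Real.log_sqrt hs0.le, hs, Real.log_sqrt hX0.le]; ring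
  have hlw : Real.log w ≤ w - 1 := Real.log_le_sub_one_of_pos hw0
  rw [hlog, ← hvv, ← hww]
  have h2 : 24.46 ≤ w * w := by nlinarith
  have h4 : 24.46 * (w * w) ≤ (w * w) * (w * w) := mul_le_mul_of_nonneg_right h2 (by positivity)
  have h5 : 0 ≤ (w - 4.946) * (24.46 * w - 23.02) := mul_nonneg (by linarith) (by linarith)
  nlinarith

/-- The final numerics: with `L ≥ 12.79`, `18 L ≤ s`, `0 ≤ 8.4 c ≤ s`, `β < 0.0474`,
`((β − 1.72)s + 1)/L + ((4.5172 s + 24.24 c + 129.84)/L² + 1.5) + (1.88 + (0.264/L + 1.1/L²)s) ≤ −8`. [folklore] -/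
private theorem clause2_numerics {s L c β : ℝ} (hL : 12.79 ≤ L) (hsL : 18 * L ≤ s) (hc : 8.4 * c ≤ s)
    (hβ : β < 0.0474) :
    ((β - 1.72) * s + 1) / L + ((4.5172 * s + 24.24 * c + 129.84) / L ^ 2 + 1.5) +
      (1.88 + (0.264 / L + 1.1 / L ^ 2) * s) ≤ -8 := by
  have hL0 : 0 < L := by linarith
  have hs0 : 0 ≤ s := by linarith
  set P1 := s / L with hP1
  set P2 := s / L ^ 2 with hP2
  set P3 := c / L ^ 2 with hP3
  set b1 := 1 / L with hb1
  set b2 := 1 / L ^ 2 with hb2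
  have hP1_0 : 0 ≤ P1 := by positivity
  have hP2_0 : 0 ≤ P2 := by positivity
  have hb1_le : b1 ≤ 0.0783 := by rw [hb1, div_le_iff₀ hL0]; nlinarith
  have hb2_le : b2 ≤ 0.00612 := by rw [hb2, div_le_iff₀ (by positivity)]; nlinarith
  have hP1_ge : 18 ≤ P1 := by rw [hP1, le_div_iff₀ hL0]; linarith
  have hP2_le : P2 ≤ 0.0783 * P1 := by
    have e : P2 = b1 * P1 := by rw [hP2, hb1, hP1]; field_simp
    rw [e]; exact mul_le_mul_of_nonneg_right hb1_le hP1_0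
  have hP3_le : 8.4 * P3 ≤ P2 := by
    have e : 8.4 * P3 = (8.4 * c) / L ^ 2 := by rw [hP3]; ring
    rw [e, hP2]
    exact div_le_div_of_nonneg_right hc (by positivity)
  have h1 : ((β - 1.72) * s + 1) / L ≤ -1.6726 * P1 + b1 := by
    have : (β - 1.72) * s ≤ -1.6726 * s := by nlinarith
    have e : (-1.6726 * s + 1) / L = -1.6726 * P1 + b1 := by rw [hP1, hb1]; ring
    rw [← e]
    exact div_le_div_of_nonneg_right (by linarith) hL0.le
  have e2 : (4.5172 * s + 24.24 * c + 129.84) / L ^ 2 = 4.5172 * P2 + 24.24 * P3 + 129.84 * b2 := by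
    rw [hP2, hP3, hb2]; ring
  have e3 : (0.264 / L + 1.1 / L ^ 2) * s = 0.264 * P1 + 1.1 * P2 := by rw [hP1, hP2]; ring
  rw [e2, e3]
  linarith

/-- `8.4 X^{1/3} ≤ √X` for `X ≥ 358801` (`8.4⁶ ≤ 358801`). [folklore] -/
private theorem rpow_third_le_sqrt {X : ℝ} (hX : 358801 ≤ X) : 8.4 * X ^ (1 / 3 : ℝ) ≤ Real.sqrt X := by
  have h := rpow_third_le (c := 8.4) (t := X) (by norm_num) (by norm_num; linarith)
  rw [le_div_iff₀ (by norm_num)] at h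
  linarith

/-! ### §7 Assembly: `X · T₂(X) ≤ −8 + κ₀` and `∫₂^X E₂ > 0` for `X ≥ 358801` under RH -/

/-- **Under RH, for every `X ≥ 358801`: `X ∫_X^∞ (π − li)/t² ≤ −8 + (2/log 2 − li 2)`**
(`piLiTail_eq` and the three terms). [cite: Zhao2025MertensMean, §2 (proof of Thm 1 for E₂)] -/
theorem mul_piLiTail_le_of_RH (hRH : RiemannHypothesis) {X : ℝ} (hX : 358801 ≤ X) :
    X * ∫ t in Ioi X, ((Nat.primeCounting ⌊t⌋₊ : ℝ) - logIntegral t) / t ^ 2 ≤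
      -8 + (2 / Real.log 2 - logIntegral 2) := by
  have hX2 : (2 : ℝ) ≤ X := by linarith
  rw [piLiTail_eq hX2]
  have hA := termA_le_of_RH hRH hX
  have hB := termB_le_of_RH hRH hX
  have hC := termC_le_of_RH hRH hX
  have hL : 12.79 ≤ Real.log X := by
    have h1 := log_X₁_gt
    have h2 : Real.log 358801 ≤ Real.log X := Real.log_le_log (by norm_num) hX
    linarith
  have hnum := clause2_numerics (β := nicolasBeta) hL (eighteen_mul_log_le_sqrt hX) (rpow_third_le_sqrt hX)
    nicolasBeta_lt'
  rw [mul_add, mul_sub]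
  linarith

/-- **Under RH, `∫₂^X E₂(x) dx > 0` for every `X ≥ 358801`** ((2.5): `∫₂^X E₂ = 2∫₂^∞ (π − li)/t² − X T₂(X)`,
`∫₂^∞ (π − li)/t² = B − li(2)/2 + log log 2` (2.4), `B > 0.26146`, `log log 2 ≥ 1 − 1/log 2`).
[cite: Zhao2025MertensMean, Thm 1 (i = 2), (a) ⟹ (b); §2 ((2.4)–(2.6))] -/
theorem integral_E₂_pos_of_RH_of_ge (hRH : RiemannHypothesis) {X : ℝ} (hX : 358801 ≤ X) :
    0 < ∫ x in (2 : ℝ)..X, E₂ x := by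
  have hB := MertensSecondChain.meisselMertens_gt
  have hX2 : (2 : ℝ) ≤ X := by linarith
  rw [integral_E₂_eq hX2]
  have hI : (∫ t in Ioi (2 : ℝ), ((Nat.primeCounting ⌊t⌋₊ : ℝ) - logIntegral t) / t ^ 2) =
      Mertens.meisselMertens - (logIntegral 2 / 2 - Real.log (Real.log 2)) := by
    rw [meisselMertens_eq_integral]; ring
  rw [hI]
  have h := mul_piLiTail_le_of_RH hRH hX
  have hl2 := Real.log_two_gt_d9
  have hl2' := Real.log_two_lt_d9
  have hll : 1 - (Real.log 2)⁻¹ ≤ Real.log (Real.log 2) := Real.one_sub_inv_le_log_of_pos (by linarith)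
  have hinv : (Real.log 2)⁻¹ ≤ 1.4427 := by
    rw [inv_le_comm₀ (by linarith) (by norm_num)]; linarith
  have e2 : 2 / Real.log 2 = 2 * (Real.log 2)⁻¹ := by ring
  rw [e2] at h
  linarith

/-! ### §8 Theorem 1, clause `i = 2`, AS PRINTED -/

/-- **Zhao 2025, Theorem 1 (`i = 2`), (a) ⟹ (b) AS PRINTED, PROVED**: under RH, `∫₂^X E₂(x) dx > 0` for EVERY
`X > 2` — for `X ≥ 358801` by the explicit §2 argument (`integral_E₂_pos_of_RH_of_ge`), below by the kernel
certificate `E₂ > 0` on `[2, 358811)` (`Zhao2025.E₂_pos_of_lt`, the source's numerical input [RS]).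
[cite: Zhao2025MertensMean, Thm 1 (i = 2), (a) ⟹ (b)] -/
theorem integral_E₂_pos_of_RH (hRH : RiemannHypothesis) {X : ℝ} (hX : 2 < X) :
    0 < ∫ x in (2 : ℝ)..X, E₂ x := by
  rcases le_or_gt 358801 X with h | h
  · exact integral_E₂_pos_of_RH_of_ge hRH h
  · exact intervalIntegral.intervalIntegral_pos_of_pos_on (intervalIntegrable_E₂ le_rfl hX.le)
      (fun x hx => E₂_pos_of_lt hx.1.le (by linarith [hx.2])) hX

end Zhao2025

/-- **Zhao 2025, Theorem 1, clause `i = 2`, AS PRINTED, PROVED**: `RH ⟺ ∫₂^X E₂(x) dx > 0` for all `X > 2`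
(`⟹`: `Zhao2025.integral_E₂_pos_of_RH`; `⟸`: `Zhao2025.riemannHypothesis_of_integral_E₂_pos`, Landau). This is the
second conjunct of the named fact `Zhao2025MertensMean_thm1`. RH-EQUIVALENT criterion; nothing here bears on the
truth of RH. [cite: Zhao2025MertensMean, Thm 1 (i = 2)] -/
theorem Zhao2025MertensMean_thm1_clause2 :
    RiemannHypothesis ↔ ∀ X : ℝ, 2 < X → 0 < ∫ x in (2 : ℝ)..X, Zhao2025.E₂ x :=
  ⟨fun hRH _ hX => Zhao2025.integral_E₂_pos_of_RH hRH hX, Zhao2025.riemannHypothesis_of_integral_E₂_pos⟩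

/-- **The named fact `Zhao2025MertensMean_thm1` (Zhao 2025, Theorem 1 for `i ∈ {1, 2}`, AS PRINTED) DISCHARGED**:
both clauses are theorems of the tree (`Zhao2025MertensMean_thm1_clause1`, `Zhao2025MertensMean_thm1_clause2`).
RH-EQUIVALENT criterion; an equivalence says nothing about the truth of RH. [cite: Zhao2025MertensMean, Thm 1] -/
theorem Zhao2025MertensMean_thm1_holds : Zhao2025MertensMean_thm1 :=
  ⟨Zhao2025MertensMean_thm1_clause1, Zhao2025MertensMean_thm1_clause2⟩

end Literature.NumberTheory.LFunctions

end
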